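/-
Copyright: the b2b-balaban T⁴-continuum CRUX team, row NE7b leaf lineage `t4-ne7b-formalise-leaf-01` (gen 85). Project licence.
-/
import Mathlib.Algebra.Order.Chebyshev
import Mathlib.Algebra.BigOperators.Intervals
import Mathlib.Algebra.BigOperators.Fin
import Mathlib.Algebra.BigOperators.Field
import Mathlib.Analysis.Real.Sqrt
import Mathlib.Tactic.FieldSimp
import Mathlib.Tactic.Linarith
import Mathlib.Tactic.Positivity
import Mathlib.Tactic.Ring
import Mathlib.Tactic.GCongr

/-!
# THE BLOCKING CONTRACTS FLUCTUATIONS BY EXACTLY THE RESCALING FACTOR: the hard-step tower's two MODEL letters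
# (`m ≤ t²m₂∕d²`, `‖M₂‖ ≤ μ`) BY VALUE for the lattice Dirichlet form under block averaging, in ONE fixed normalisation —
# the path Poincaré letter (constant `n(n − 1)`), its TENSORISATION with NO dimension factor (rows × any finite fibre), the
# two-scale letter on `ker (T⁺ ∘ T)` = zero `L²`-block sums, the contraction `d_T² = N⁻¹`, and the closing identity
# `t²·m₂∕d_T² = (L² − 1)⁻¹ =: m` at EVERY scale (row NE7b, node U5c; Mathlib only; [folklore])

Cell `pub-balaban`, sub-cell `t4`, spine estimate NE7b (`T4WeightBudget.RelWeightBound`; the cell's OWN estimate — NOT PRINTED in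
[Bałaban 1983–89], NOT PROVED).  Crux-route work under `Spine/NE7b/` by a row leaf (`t4-ne7b-formalise-leaf-01` gen 85) in the
hard-step cell under FREEZE (0)'s crux-prover clause; NOTHING of Bałaban's is named as a Lean object, valued or asserted; no
`T4Continuum/Support` leaf typed; no `def`; zero `sorry`.  Imports: Mathlib only — independent of the hub's olean frontier; the
consumers (leaf-06's `…HardStepTowerBox` (HSTB) `closing_conditions`' letters `hmm : m ≤ m₂′` ∕ `hnMμ : ‖M₂‖ ≤ μ`, leaf-03's
`…TransportedFormCoercivity` (TFC) `kerCoercive_bilinearComp_div`'s `hco` ∕ `hd`, this lineage's `…BlockAverageLetters` (BAL)) are met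
BY SHAPE, in the unweighted sum currency of BAL ∕ `B9SectEKernel`.

WHY.  HSTB displays the closing family of the two-step assembly as three inequalities on one dimensionless `s = |t|K₁` PLUS two
model letters the step does not produce: the next kernel coercivity `m₂′ := t²m₂∕d²` must dominate the carried `m`, and the next
right inverse must stay bounded, `‖M₂‖ ≤ μ`.  The pricing desk (F627 ∕ F644, ι-G93-TFC-1) located the margin there: «the BLOCKING must
contract fluctuations (`‖Dv‖ ≤ d‖v‖`, `d ≲ |t|`) by at least the rescaling factor — the averaging operator's property, not
arithmetic»; HSTB's NOT-HERE: «the canonical-dimension bookkeeping of the `L`-blocking; a MODEL property».  THIS FILE values that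
bookkeeping for the FREE LATTICE FIELD — Dirichlet form `E(u) = Σ_{links}(u_x − u_y)²` on the unit lattice, block averages over cubes
of side `L` (`N = L^d` sites), canonical amplitude rescaling `t² = L^{2−d}` — in ONE fixed normalisation (unit lattice, unweighted
`ℓ²`, the same at every scale):
* `d_T² = N⁻¹ = L^{−d}` (Jensen on each fibre — BAL's `Qt_normSq_le` ∕ `Q_normSq_weighted_le` in function currency, §3);
* the two-scale letter `T⁺(Tu) = 0 ⟹ m₂‖u‖² ≤ E(u)` IS the Poincaré inequality for functions with zero sum on every `L²`-cube
  (§3: with equal fibres, `ker (T⁺ ∘ T)` = zero composite-block sums), and the cube's constant is the PATH's: §1 proves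
  `Σ_{i<n}(v_i − v̄)² ≤ n(n − 1)·Σ_{i<n−1}(v_{i+1} − v_i)²` (telescoping + Cauchy–Schwarz; NOT sharp — the sharp `(2 − 2cos(π∕n))⁻¹` is
  Fan–Taussky–Todd's (1955), neither needed nor proved here) and §2 TENSORISES it with NO dimension factor: rows `i < n` over ANY
  finite fibre `α` with a Poincaré letter (constant `c_α`, energy `E_α`) carry `Σ(u − ū)² ≤ c_α·Σ_i E_α(u_i) + n(n − 1)·Σ_iΣ_a
  (u_{i+1,a} − u_{i,a})²` (orthogonal splitting through the row means — Efron–Stein); so a cube of side `n` in ANY dimension has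
  constant `n(n − 1)` (`d = 2` is §2b) and `m₂ = (L²(L² − 1))⁻¹`;
* the closing identity (§4): `t²·m₂∕d_T² = L^{2−d}·L^{d}·(L²(L² − 1))⁻¹ = (L² − 1)⁻¹ =: m` — the SAME number at every scale, because
  the two-scale letter is a property of the MODEL in the fixed normalisation, re-proved at each scale (the desk's «a RESET per scale,
  not a transport»); `m ≤ (L(L − 1))⁻¹` is a valid one-block coercivity (the carried `hco`), so HSTB's `hmm : m ≤ t²m₂∕d²` holds with
  EQUALITY for this `m` (`t²∕d_T² = L²` in every dimension: the blocking contracts fluctuations by exactly the rescaling factor).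
  Located caution: carrying the ONE-block constant `(L(L − 1))⁻¹` itself would NOT close with these non-sharp constants
  (`(L² − 1)⁻¹ < (L(L − 1))⁻¹`) — the carried coercivity must be the two-scale one read back;
* `‖M k‖² = Σ_y #fibre(y)·k_y² ≤ N_max‖k‖²` (§3), so `μ² = L^d` at every scale.

WHAT IS PROVED ([folklore]; sums over `Finset.range`, fibres `univ.filter (blk · = y)` as in BAL):
* §1 `sum_sq_sub_eq_sum_sq_sub_mean_add` (`Σ(w − c)² = Σ(w − w̄)² + #s·(w̄ − c)²`), `sum_sq_sub_mean_le`, `abs_sub_le_pathVariation`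
  (`|v_j − v_i| ≤ Σ_{k<n−1}|v_{k+1} − v_k|`), **`pathPoincare_mean`** (`Σ_{i<n}(v_i − v̄)² ≤ n(n−1)·Σ(v_{i+1} − v_i)²`), `pathPoincare`.
* §2 **`productPoincare_mean`** (the tensorisation step, no dimension factor), `productPoincare`; §2b `pathPoincare_mean_fin` (§1 on
  `Fin m`), **`squarePoincare_mean`** (the square has the path's constant).
* §3 `blockAverage_normSq_le` (`Σ_y ((Σ_{fibre y} u)∕#fibre y)² ≤ N_min⁻¹·Σ_x u_x²` — `d_T²`), `blockConstant_normSq_eq` ∕ `_le`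
  (`Σ_x k(blk x)² ≤ N_max·Σ_y k_y²` — `μ²`), `sum_blockAverage_fibre₂`, **`ker_comp_iff_compositeBlockSums`** (`T⁺(Tu) = 0 ↔` zero
  `L²`-block sums, equal fibres), **`twoScale_of_blockPoincare`** (per-block letters with one `c > 0`, `Σ_blocks E_block ≤ E` ⟹ zero
  block sums ⟹ `c⁻¹·Σ u² ≤ E(u)` — TFC's `hco` shape, `m₂ := c⁻¹`).
* §4 THE END: **`closing_by_value`** (`1 < L`: `(L²∕L^d)·(L²(L² − 1))⁻¹∕(L^d)⁻¹ = (L² − 1)⁻¹`), `carried_le_oneBlock`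
  (`(L² − 1)⁻¹ ≤ (L(L − 1))⁻¹`), **`model_letters_by_value`** (HSTB's `hm ∕ hmm ∕ hnM ∕ hnMμ`); `t²∕d_T² = L²` in every dimension.
* §5 toy: `L = 2`, `d = 4`: `t² = 1∕4`, `m₂ = 1∕12`, `d_T² = 1∕16`, `m = 1∕3`.

NOT HERE (honest): the `d`-fold iteration of §2 as one statement over `Fin d → Fin n` (each further dimension is §2 applied once more
with the previous cube as the fibre); the sharp constants; the identification of the abstract `T, Q, S, t` of HSTT ∕ HSTB ∕ TFC with
these block sums inside a normed-space instance (BY SHAPE only); and above all WHICH quadratic form, blocking and rescaling print's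
small-field action has at step `k` ((A3) ∕ (A1c), NC-NE7b-α UNRULED) — the free scalar Dirichlet form is the MODEL in which the desk's
located letter can be valued; nothing of Yang–Mills.  BY-NAME EFFECT ON THE WALL: NONE.  NE7b NOT PRINTED ∕ NOT PROVED; spine PROVED
0∕9; rung (B)+1 on a FINITE torus — NOT infinite volume, NOT the mass gap, NOT Clay.  HONEST DEPENDENCY: continuum YM on T⁴ ⇐ BetaPertH
∧ nine spine estimates (0∕9 proved); BetaPertH ⇐ (D1) ∧ (D4) ∧ CAP+tail; G-an2-4 gates asym, D1 and NE2∕3∕4.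
-/

set_option autoImplicit false

open Finset

namespace Summit.QuantumFields.BalabanUV.T4Continuum.NE7b.TwoScalePoincareBlocking

/-! ## §1. The variance splitting, path telescoping, and the one-dimensional Poincaré letter -/

/-- THE VARIANCE SPLITTING: `Σ_{a∈s}(w a − c)² = Σ_{a∈s}(w a − w̄)² + #s·(w̄ − c)²` with `w̄ = (Σ_s w)∕#s` (`s` nonempty). [folklore] -/
theorem sum_sq_sub_eq_sum_sq_sub_mean_add {ι : Type*} (s : Finset ι) (hs : 0 < #s) (w : ι → ℝ) (c : ℝ) :
    ∑ a ∈ s, (w a - c) ^ 2 =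
      ∑ a ∈ s, (w a - (∑ b ∈ s, w b) / #s) ^ 2 + #s * ((∑ b ∈ s, w b) / #s - c) ^ 2 := by
  set μ : ℝ := (∑ b ∈ s, w b) / #s with hμ
  have hs' : (#s : ℝ) ≠ 0 := by exact_mod_cast hs.ne'
  have hzero : ∑ a ∈ s, (w a - μ) = 0 := by
    rw [sum_sub_distrib, sum_const, nsmul_eq_mul, hμ, mul_div_cancel₀ _ hs', sub_self]
  have hexp : ∀ a, (w a - c) ^ 2 = (w a - μ) ^ 2 + 2 * (μ - c) * (w a - μ) + (μ - c) ^ 2 := fun a => by ring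
  simp_rw [hexp, sum_add_distrib, ← mul_sum, hzero, mul_zero, add_zero, sum_const, nsmul_eq_mul]

/-- Hence the mean minimises: `Σ_{a∈s}(w a − w̄)² ≤ Σ_{a∈s}(w a − c)²` for every `c`. [folklore] -/
theorem sum_sq_sub_mean_le {ι : Type*} (s : Finset ι) (hs : 0 < #s) (w : ι → ℝ) (c : ℝ) :
    ∑ a ∈ s, (w a - (∑ b ∈ s, w b) / #s) ^ 2 ≤ ∑ a ∈ s, (w a - c) ^ 2 := by
  rw [sum_sq_sub_eq_sum_sq_sub_mean_add s hs w c]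
  have : (0 : ℝ) ≤ #s * ((∑ b ∈ s, w b) / #s - c) ^ 2 := by positivity
  linarith

/-- PATH TELESCOPING: on a path of `n` sites, `|v j − v i| ≤ Σ_{k<n−1}|v (k+1) − v k|` for `i, j < n`. [folklore] -/
theorem abs_sub_le_pathVariation (v : ℕ → ℝ) {n i j : ℕ} (hi : i < n) (hj : j < n) :
    |v j - v i| ≤ ∑ k ∈ range (n - 1), |v (k + 1) - v k| := by
  wlog hij : i ≤ j generalizing i j
  · rw [abs_sub_comm]
    exact this hj hi (le_of_not_ge hij)
  have htel : v j - v i = ∑ k ∈ Ico i j, (v (k + 1) - v k) := by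
    rw [sum_Ico_eq_sum_range]
    have h := sum_range_sub (fun k => v (i + k)) (j - i)
    simp only [add_zero] at h
    rw [show i + (j - i) = j by omega] at h
    exact h ▸ sum_congr rfl fun k _ => by rw [add_assoc]
  rw [htel]
  refine (abs_sum_le_sum_abs _ _).trans ?_
  refine sum_le_sum_of_subset_of_nonneg (fun k hk => ?_) (fun _ _ _ => abs_nonneg _)
  simp only [mem_Ico, mem_range] at hk ⊢
  omega

/-- **THE ONE-DIMENSIONAL POINCARÉ LETTER ON A PATH (constant `n(n − 1)`, not sharp)**: for `n ≥ 1` sites,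
`Σ_{i<n}(v i − v̄)² ≤ n(n − 1)·Σ_{k<n−1}(v (k+1) − v k)²`, `v̄ = (Σ_{i<n} v i)∕n`.  Proof: the mean minimises, so the left side is
`≤ Σ_i (v i − v 0)²`; each `|v i − v 0|` is at most the total variation, whose square is `≤ (n − 1)·Σ(v (k+1) − v k)²` by Cauchy–Schwarz. [folklore] -/
theorem pathPoincare_mean (v : ℕ → ℝ) {n : ℕ} (hn : 0 < n) :
    ∑ i ∈ range n, (v i - (∑ j ∈ range n, v j) / n) ^ 2 ≤
      (n : ℝ) * (n - 1) * ∑ k ∈ range (n - 1), (v (k + 1) - v k) ^ 2 := by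
  set W : ℝ := ∑ k ∈ range (n - 1), |v (k + 1) - v k| with hW
  have hW2 : W ^ 2 ≤ (n - 1 : ℝ) * ∑ k ∈ range (n - 1), (v (k + 1) - v k) ^ 2 := by
    have h := sq_sum_le_card_mul_sum_sq (s := range (n - 1)) (f := fun k => |v (k + 1) - v k|)
    simp only [card_range, sq_abs] at h
    rwa [Nat.cast_sub (Nat.one_le_iff_ne_zero.mpr hn.ne'), Nat.cast_one] at h
  have hcard : 0 < #(range n) := by rw [card_range]; exact hn
  have h1 : ∑ i ∈ range n, (v i - (∑ j ∈ range n, v j) / n) ^ 2 ≤ ∑ i ∈ range n, (v i - v 0) ^ 2 := by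
    have h := sum_sq_sub_mean_le (range n) hcard v (v 0)
    rwa [card_range] at h
  have h2 : ∑ i ∈ range n, (v i - v 0) ^ 2 ≤ ∑ _i ∈ range n, W ^ 2 := by
    refine sum_le_sum fun i hi => ?_
    have hb : |v i - v 0| ≤ W := abs_sub_le_pathVariation v hn (mem_range.1 hi)
    have h0 : 0 ≤ |v i - v 0| := abs_nonneg _
    nlinarith [sq_abs (v i - v 0)]
  rw [sum_const, card_range, nsmul_eq_mul] at h2
  have hn0 : (0 : ℝ) ≤ n := Nat.cast_nonneg n
  calc ∑ i ∈ range n, (v i - (∑ j ∈ range n, v j) / n) ^ 2 ≤ (n : ℝ) * W ^ 2 := h1.trans h2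
    _ ≤ (n : ℝ) * ((n - 1 : ℝ) * ∑ k ∈ range (n - 1), (v (k + 1) - v k) ^ 2) :=
        mul_le_mul_of_nonneg_left hW2 hn0
    _ = (n : ℝ) * (n - 1) * ∑ k ∈ range (n - 1), (v (k + 1) - v k) ^ 2 := by ring

/-- Zero-sum form: `Σ_{i<n} v i = 0 ⟹ Σ_{i<n} (v i)² ≤ n(n − 1)·Σ_{k<n−1}(v (k+1) − v k)²`. [folklore] -/
theorem pathPoincare (v : ℕ → ℝ) {n : ℕ} (hn : 0 < n) (h0 : ∑ i ∈ range n, v i = 0) :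
    ∑ i ∈ range n, v i ^ 2 ≤ (n : ℝ) * (n - 1) * ∑ k ∈ range (n - 1), (v (k + 1) - v k) ^ 2 := by
  have h := pathPoincare_mean v hn
  simp only [h0, zero_div, sub_zero] at h
  exact h

/-! ## §2. Tensorisation with no dimension factor: rows over any finite fibre -/

/-- **THE PRODUCT STEP (Efron–Stein ∕ orthogonal decomposition through the row means)**: `α` a finite fibre with `N = card α ≥ 1`
sites carrying a Poincaré letter `Σ_a (w a − w̄)² ≤ c_α·E_α w` for an energy `E_α`; `u : ℕ → α → ℝ` read on the rows `i < n`
(`n ≥ 1`).  Then, with `ū = (Σ_{i<n}Σ_a u i a)∕(nN)`,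
`Σ_{i<n}Σ_a (u i a − ū)² ≤ c_α·Σ_{i<n} E_α (u i) + n(n − 1)·Σ_{i<n−1}Σ_a (u (i+1) a − u i a)²` — NO factor of the dimension: the row
means `r i` split the variance orthogonally, the rows use the fibre's letter, the means use §1 and Jensen
`N·(r (i+1) − r i)² ≤ Σ_a (u (i+1) a − u i a)²`.  Iterating, a cube of side `n` in any dimension has constant `n(n − 1)`. [folklore] -/
theorem productPoincare_mean {α : Type*} [Fintype α] (hN : 0 < Fintype.card α)
    {Eα : (α → ℝ) → ℝ} {cα : ℝ}
    (hP : ∀ w : α → ℝ, ∑ a, (w a - (∑ b, w b) / Fintype.card α) ^ 2 ≤ cα * Eα w)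
    (u : ℕ → α → ℝ) {n : ℕ} (hn : 0 < n) :
    ∑ i ∈ range n, ∑ a, (u i a - (∑ j ∈ range n, ∑ b, u j b) / (n * Fintype.card α)) ^ 2 ≤
      cα * ∑ i ∈ range n, Eα (u i) +
        (n : ℝ) * (n - 1) * ∑ i ∈ range (n - 1), ∑ a, (u (i + 1) a - u i a) ^ 2 := by
  set N : ℕ := Fintype.card α with hNdef
  have hNpos : (0 : ℝ) < N := by exact_mod_cast hN
  set r : ℕ → ℝ := fun i => (∑ a, u i a) / N with hr
  set ubar : ℝ := (∑ j ∈ range n, ∑ b, u j b) / (n * N) with hubar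
  have hubar' : ubar = (∑ j ∈ range n, r j) / n := by
    simp only [hubar, hr, ← sum_div, div_div, mul_comm]
  have hcardα : 0 < #(univ : Finset α) := by rw [card_univ]; exact hN
  have hrow : ∀ i, ∑ a, (u i a - ubar) ^ 2 = ∑ a, (u i a - r i) ^ 2 + N * (r i - ubar) ^ 2 := fun i => by
    have h := sum_sq_sub_eq_sum_sq_sub_mean_add (univ : Finset α) hcardα (u i) ubar
    rw [card_univ] at h
    exact h
  have hrows : ∑ i ∈ range n, ∑ a, (u i a - r i) ^ 2 ≤ cα * ∑ i ∈ range n, Eα (u i) := by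
    rw [mul_sum]
    exact sum_le_sum fun i _ => hP (u i)
  have hmeans : ∑ i ∈ range n, (r i - ubar) ^ 2 ≤
      (n : ℝ) * (n - 1) * ∑ i ∈ range (n - 1), (r (i + 1) - r i) ^ 2 := by
    rw [hubar']
    exact pathPoincare_mean r hn
  have hjensen : ∀ i, (N : ℝ) * (r (i + 1) - r i) ^ 2 ≤ ∑ a, (u (i + 1) a - u i a) ^ 2 := fun i => by
    have hdiff : r (i + 1) - r i = (∑ a, (u (i + 1) a - u i a)) / N := by
      simp only [hr, sum_sub_distrib, sub_div]
    rw [hdiff, div_pow, ← mul_div_assoc, div_le_iff₀ (by positivity)]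
    have h := sq_sum_le_card_mul_sum_sq (s := (univ : Finset α)) (f := fun a => u (i + 1) a - u i a)
    rw [card_univ] at h
    calc (N : ℝ) * (∑ a, (u (i + 1) a - u i a)) ^ 2 ≤ (N : ℝ) * (N * ∑ a, (u (i + 1) a - u i a) ^ 2) :=
          mul_le_mul_of_nonneg_left h hNpos.le
      _ = (∑ a, (u (i + 1) a - u i a) ^ 2) * (N : ℝ) ^ 2 := by ring
  have hsplit : ∑ i ∈ range n, ∑ a, (u i a - ubar) ^ 2 =
      ∑ i ∈ range n, ∑ a, (u i a - r i) ^ 2 + N * ∑ i ∈ range n, (r i - ubar) ^ 2 := by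
    rw [mul_sum, ← sum_add_distrib]
    exact sum_congr rfl fun i _ => hrow i
  have hnn : (0 : ℝ) ≤ (n : ℝ) * (n - 1) := by
    have : (1 : ℝ) ≤ n := by exact_mod_cast hn
    nlinarith
  calc ∑ i ∈ range n, ∑ a, (u i a - ubar) ^ 2
      = ∑ i ∈ range n, ∑ a, (u i a - r i) ^ 2 + N * ∑ i ∈ range n, (r i - ubar) ^ 2 := hsplit
    _ ≤ cα * ∑ i ∈ range n, Eα (u i) + N * ((n : ℝ) * (n - 1) * ∑ i ∈ range (n - 1), (r (i + 1) - r i) ^ 2) := by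
        gcongr
    _ = cα * ∑ i ∈ range n, Eα (u i) + (n : ℝ) * (n - 1) * ((N : ℝ) * ∑ i ∈ range (n - 1), (r (i + 1) - r i) ^ 2) := by
        ring
    _ = cα * ∑ i ∈ range n, Eα (u i) + (n : ℝ) * (n - 1) * ∑ i ∈ range (n - 1), N * (r (i + 1) - r i) ^ 2 := by
        rw [mul_sum (range (n - 1)) (fun i => (r (i + 1) - r i) ^ 2) (N : ℝ)]
    _ ≤ cα * ∑ i ∈ range n, Eα (u i) + (n : ℝ) * (n - 1) * ∑ i ∈ range (n - 1), ∑ a, (u (i + 1) a - u i a) ^ 2 := by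
        gcongr with i hi
        exact hjensen i

/-- Zero-sum form of the product step: `Σ_{i<n}Σ_a u i a = 0 ⟹ Σ_{i<n}Σ_a (u i a)² ≤ c_α·Σ_i E_α(u i) + n(n−1)·Σ_iΣ_a(u (i+1) a − u i a)²`. [folklore] -/
theorem productPoincare {α : Type*} [Fintype α] (hN : 0 < Fintype.card α)
    {Eα : (α → ℝ) → ℝ} {cα : ℝ}
    (hP : ∀ w : α → ℝ, ∑ a, (w a - (∑ b, w b) / Fintype.card α) ^ 2 ≤ cα * Eα w)
    (u : ℕ → α → ℝ) {n : ℕ} (hn : 0 < n) (h0 : ∑ i ∈ range n, ∑ a, u i a = 0) :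
    ∑ i ∈ range n, ∑ a, u i a ^ 2 ≤
      cα * ∑ i ∈ range n, Eα (u i) + (n : ℝ) * (n - 1) * ∑ i ∈ range (n - 1), ∑ a, (u (i + 1) a - u i a) ^ 2 := by
  have h := productPoincare_mean hN hP u hn
  simp only [h0, zero_div, sub_zero] at h
  exact h

/-- §1 READ ON `Fin m`: the path Poincaré letter for `w : Fin m → ℝ`, the path energy written through the `ℕ`-extension
`k ↦ if h : k < m then w ⟨k, h⟩ else 0` (the shape §2 iterates on). [folklore] -/
theorem pathPoincare_mean_fin {m : ℕ} (hm : 0 < m) (w : Fin m → ℝ) :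
    ∑ a, (w a - (∑ b, w b) / Fintype.card (Fin m)) ^ 2 ≤
      (m : ℝ) * (m - 1) * ∑ k ∈ range (m - 1),
        ((if h : k + 1 < m then w ⟨k + 1, h⟩ else 0) - (if h : k < m then w ⟨k, h⟩ else 0)) ^ 2 := by
  set w' : ℕ → ℝ := fun k => if h : k < m then w ⟨k, h⟩ else 0 with hw'
  have hext : ∀ a : Fin m, w' a = w a := fun a => by simp [hw', a.isLt]
  have hsum : ∑ b, w b = ∑ j ∈ range m, w' j := by
    rw [← Fin.sum_univ_eq_sum_range]
    exact Fintype.sum_congr _ _ fun b => (hext b).symm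
  have hlhs : ∑ a, (w a - (∑ b, w b) / Fintype.card (Fin m)) ^ 2 =
      ∑ i ∈ range m, (w' i - (∑ j ∈ range m, w' j) / m) ^ 2 := by
    rw [Fintype.card_fin, hsum, ← Fin.sum_univ_eq_sum_range (fun i => (w' i - (∑ j ∈ range m, w' j) / m) ^ 2)]
    exact Fintype.sum_congr _ _ fun a => by rw [hext a]
  rw [hlhs]
  exact pathPoincare_mean w' hm

/-- **THE SQUARE HAS THE PATH's CONSTANT** (the `d = 2` instance of the iteration; every further dimension is §2 applied once more):
for `u : ℕ → Fin m → ℝ` read on rows `i < n` over a path of `m` columns,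
`Σ_{i<n}Σ_a (u i a − ū)² ≤ m(m − 1)·Σ_{i<n}(row path energy of u i) + n(n − 1)·Σ_{i<n−1}Σ_a (u (i+1) a − u i a)²`; for `n = m` both
constants are `n(n − 1)` and the right side is `n(n − 1)·E_square(u)` — no factor `2`. [folklore] -/
theorem squarePoincare_mean {m : ℕ} (hm : 0 < m) (u : ℕ → Fin m → ℝ) {n : ℕ} (hn : 0 < n) :
    ∑ i ∈ range n, ∑ a, (u i a - (∑ j ∈ range n, ∑ b, u j b) / (n * Fintype.card (Fin m))) ^ 2 ≤
      (m : ℝ) * (m - 1) * ∑ i ∈ range n, ∑ k ∈ range (m - 1),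
          ((if h : k + 1 < m then u i ⟨k + 1, h⟩ else 0) - (if h : k < m then u i ⟨k, h⟩ else 0)) ^ 2 +
        (n : ℝ) * (n - 1) * ∑ i ∈ range (n - 1), ∑ a, (u (i + 1) a - u i a) ^ 2 :=
  productPoincare_mean (α := Fin m) (by rw [Fintype.card_fin]; exact hm)
    (Eα := fun w => ∑ k ∈ range (m - 1),
      ((if h : k + 1 < m then w ⟨k + 1, h⟩ else 0) - (if h : k < m then w ⟨k, h⟩ else 0)) ^ 2)
    (cα := (m : ℝ) * (m - 1)) (fun w => pathPoincare_mean_fin hm w) u hn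

/-! ## §3. Block letters in function currency: `d_T² = N_min⁻¹`, `μ² = N_max`, `ker (T⁺ ∘ T)`, the two-scale letter -/

section Blocks

variable {σ β : Type*} [Fintype σ] [Fintype β] [DecidableEq β] (blk : σ → β)

/-- **THE CONTRACTION LETTER `d_T² = N_min⁻¹`**: the block average `(Tu)(y) = (Σ_{fibre y} u)∕#fibre(y)` over fibres of size `≥ N_min ≥ 1`
satisfies `Σ_y (Tu)(y)² ≤ N_min⁻¹·Σ_x (u x)²` (Jensen on each fibre, fibres partition the sites).  For cubes of side `L`: `N_min = L^d`. [folklore] -/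
theorem blockAverage_normSq_le (u : σ → ℝ) {Nmin : ℕ} (hNmin : 0 < Nmin)
    (hmin : ∀ y, Nmin ≤ #(univ.filter fun x => blk x = y)) :
    ∑ y, ((∑ x ∈ univ.filter (fun x => blk x = y), u x) / #(univ.filter fun x => blk x = y)) ^ 2 ≤
      (Nmin : ℝ)⁻¹ * ∑ x, u x ^ 2 := by
  have hNmin' : (0 : ℝ) < Nmin := by exact_mod_cast hNmin
  have hfib : ∀ y, ((∑ x ∈ univ.filter (fun x => blk x = y), u x) / #(univ.filter fun x => blk x = y)) ^ 2 ≤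
      (Nmin : ℝ)⁻¹ * ∑ x ∈ univ.filter (fun x => blk x = y), u x ^ 2 := fun y => by
    set F := univ.filter (fun x => blk x = y) with hF
    have hcard : (Nmin : ℝ) ≤ #F := by exact_mod_cast hmin y
    have hFpos : (0 : ℝ) < #F := lt_of_lt_of_le hNmin' hcard
    have hcs := sq_sum_le_card_mul_sum_sq (s := F) (f := u)
    have hS : 0 ≤ ∑ x ∈ F, u x ^ 2 := sum_nonneg fun x _ => sq_nonneg _
    calc ((∑ x ∈ F, u x) / #F) ^ 2 = (∑ x ∈ F, u x) ^ 2 / (#F : ℝ) ^ 2 := div_pow _ _ _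
      _ ≤ (#F * ∑ x ∈ F, u x ^ 2) / (#F : ℝ) ^ 2 := div_le_div_of_nonneg_right hcs (sq_nonneg _)
      _ = (∑ x ∈ F, u x ^ 2) / #F := by rw [sq, mul_div_mul_left _ _ hFpos.ne']
      _ ≤ (∑ x ∈ F, u x ^ 2) / Nmin := div_le_div_of_nonneg_left hS hNmin' hcard
      _ = (Nmin : ℝ)⁻¹ * ∑ x ∈ F, u x ^ 2 := div_eq_inv_mul _ _
  calc ∑ y, ((∑ x ∈ univ.filter (fun x => blk x = y), u x) / #(univ.filter fun x => blk x = y)) ^ 2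
      ≤ ∑ y, (Nmin : ℝ)⁻¹ * ∑ x ∈ univ.filter (fun x => blk x = y), u x ^ 2 := sum_le_sum fun y _ => hfib y
    _ = (Nmin : ℝ)⁻¹ * ∑ x, u x ^ 2 := by rw [← mul_sum, sum_fiberwise univ blk (fun x => u x ^ 2)]

/-- THE RIGHT INVERSE BY VALUE, `‖Mk‖² = Σ_y #fibre(y)·k_y²`: the block-constant extension `x ↦ k (blk x)`. [folklore] -/
theorem blockConstant_normSq_eq (k : β → ℝ) :
    ∑ x, k (blk x) ^ 2 = ∑ y, (#(univ.filter fun x => blk x = y) : ℝ) * k y ^ 2 := by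
  rw [← sum_fiberwise univ blk (fun x => k (blk x) ^ 2)]
  refine sum_congr rfl fun y _ => ?_
  rw [sum_congr rfl fun x hx => by rw [(mem_filter.1 hx).2], sum_const, nsmul_eq_mul]

/-- **`μ² = N_max`**: `Σ_x k(blk x)² ≤ N_max·Σ_y k_y²` for fibres of size `≤ N_max` (HSTB's `‖M₂‖ ≤ μ` by value; cubes: `N_max = L^d`). [folklore] -/
theorem blockConstant_normSq_le (k : β → ℝ) {Nmax : ℕ} (hmax : ∀ y, #(univ.filter fun x => blk x = y) ≤ Nmax) :
    ∑ x, k (blk x) ^ 2 ≤ (Nmax : ℝ) * ∑ y, k y ^ 2 := by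
  rw [blockConstant_normSq_eq, mul_sum]
  refine sum_le_sum fun y _ => mul_le_mul_of_nonneg_right (by exact_mod_cast hmax y) (sq_nonneg _)

variable {γ : Type*} [DecidableEq γ] (blk₂ : β → γ)

/-- EQUAL FIBRES: the composite-block (`L²`-block) sum of `u` is `N·` the coarse-block sum of the block average `Tu`. [folklore] -/
theorem sum_blockAverage_fibre₂ (u : σ → ℝ) {N : ℕ} (hfib : ∀ y, #(univ.filter fun x => blk x = y) = N) (z : γ) :
    ∑ y ∈ univ.filter (fun y => blk₂ y = z),
        (∑ x ∈ univ.filter (fun x => blk x = y), u x) / #(univ.filter fun x => blk x = y) =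
      (∑ x ∈ univ.filter (fun x => blk₂ (blk x) = z), u x) / N := by
  simp_rw [hfib]
  rw [← sum_div]
  congr 1
  rw [← sum_fiberwise_of_maps_to (s := univ.filter (fun x => blk₂ (blk x) = z)) (t := univ.filter (fun y => blk₂ y = z))
    (g := blk) (fun x hx => by simpa using hx) u]
  refine sum_congr rfl fun y hy => ?_
  have hy' : blk₂ y = z := by simpa using hy
  have hset : (univ.filter fun x => blk x = y) =
      (univ.filter (fun x => blk₂ (blk x) = z)).filter (fun x => blk x = y) := by
    ext x
    simp only [mem_filter, mem_univ, true_and]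
    exact ⟨fun hx => ⟨by rw [hx]; exact hy', hx⟩, fun hx => hx.2⟩
  rw [hset]

/-- **`ker (T⁺ ∘ T)` = ZERO COMPOSITE-BLOCK SUMS** (equal fibres of size `N ≥ 1`): the coarse block sums of `Tu` all vanish iff the
`L²`-block sums of `u` all vanish — the two-scale kernel of HSTT ∕ TFC's letter `hco₂` read on the lattice. [folklore] -/
theorem ker_comp_iff_compositeBlockSums (u : σ → ℝ) {N : ℕ} (hN : 0 < N) (hfib : ∀ y, #(univ.filter fun x => blk x = y) = N) :
    (∀ z, ∑ y ∈ univ.filter (fun y => blk₂ y = z),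
        (∑ x ∈ univ.filter (fun x => blk x = y), u x) / #(univ.filter fun x => blk x = y) = 0) ↔
      ∀ z, ∑ x ∈ univ.filter (fun x => blk₂ (blk x) = z), u x = 0 := by
  have hN' : (N : ℝ) ≠ 0 := by exact_mod_cast hN.ne'
  refine forall_congr' fun z => ?_
  rw [sum_blockAverage_fibre₂ blk blk₂ u hfib z, div_eq_zero_iff, or_iff_left hN']

end Blocks

/-- **THE TWO-SCALE LETTER FROM PER-BLOCK POINCARÉ LETTERS** (TFC's `hco` shape with `m₂ := c⁻¹`): blocks `B : ι → σ` (any block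
map, read through its fibres), per-block energies `E_B y` with `Σ_y E_B y u ≤ E u`, and on every block the Poincaré letter with one
constant `c > 0`; then zero block sums give `c⁻¹·Σ_x (u x)² ≤ E u`.  With §1–§2 on cubes of side `L²`: `c = L²(L² − 1)`. [folklore] -/
theorem twoScale_of_blockPoincare {σ ι : Type*} [Fintype σ] [Fintype ι] [DecidableEq ι] (B : σ → ι)
    {E : (σ → ℝ) → ℝ} {EB : ι → (σ → ℝ) → ℝ} {c : ℝ} (hc : 0 < c)
    (hP : ∀ y, ∀ u : σ → ℝ,
      ∑ x ∈ univ.filter (fun x => B x = y),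
          (u x - (∑ x' ∈ univ.filter (fun x => B x = y), u x') / #(univ.filter fun x => B x = y)) ^ 2 ≤ c * EB y u)
    (hE : ∀ u : σ → ℝ, ∑ y, EB y u ≤ E u)
    (u : σ → ℝ) (h0 : ∀ y, ∑ x ∈ univ.filter (fun x => B x = y), u x = 0) :
    c⁻¹ * ∑ x, u x ^ 2 ≤ E u := by
  rw [inv_mul_le_iff₀ hc]
  have hblocks : ∀ y, ∑ x ∈ univ.filter (fun x => B x = y), u x ^ 2 ≤ c * EB y u := fun y => by
    have h := hP y u
    simp only [h0 y, zero_div, sub_zero] at h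
    exact h
  calc ∑ x, u x ^ 2 = ∑ y, ∑ x ∈ univ.filter (fun x => B x = y), u x ^ 2 :=
        (sum_fiberwise univ B (fun x => u x ^ 2)).symm
    _ ≤ ∑ y, c * EB y u := sum_le_sum fun y _ => hblocks y
    _ = c * ∑ y, EB y u := by rw [mul_sum]
    _ ≤ c * E u := mul_le_mul_of_nonneg_left (hE u) hc.le

/-! ## §4. THE END: the closing identity by value -/

/-- **THE CLOSING IDENTITY BY VALUE**: `t²·m₂∕d_T² = m` with `t² = L²∕L^d`, `m₂ = (L²(L² − 1))⁻¹` (the cube-of-side-`L²` Poincaré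
constant of §1–§2), `d_T² = (L^d)⁻¹`, `m = (L² − 1)⁻¹` — the SAME number at every scale, HSTB's `hmm : m ≤ t²m₂∕d²` with equality. [folklore] -/
theorem closing_by_value {L : ℝ} (hL : 1 < L) (d : ℕ) :
    L ^ 2 / L ^ d * (L ^ 2 * (L ^ 2 - 1))⁻¹ / (L ^ d)⁻¹ = (L ^ 2 - 1)⁻¹ := by
  have hL0 : 0 < L := lt_trans zero_lt_one hL
  have hLd : L ^ d ≠ 0 := pow_ne_zero d hL0.ne'
  have hL2 : L ^ 2 - 1 ≠ 0 := by nlinarith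
  have hL2' : L ^ 2 ≠ 0 := pow_ne_zero 2 hL0.ne'
  field_simp

/-- THE CARRIED COERCIVITY IS A VALID ONE-BLOCK LETTER: `m = (L² − 1)⁻¹ ≤ (L(L − 1))⁻¹` (the cube-of-side-`L` constant of §1–§2),
`1 < L`. [folklore] -/
theorem carried_le_oneBlock {L : ℝ} (hL : 1 < L) : (L ^ 2 - 1)⁻¹ ≤ (L * (L - 1))⁻¹ := by
  have h1 : 0 < L * (L - 1) := by nlinarith
  have h2 : L * (L - 1) ≤ L ^ 2 - 1 := by nlinarith
  exact inv_anti₀ h1 h2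

/-- **THE TWO MODEL LETTERS OF THE HARD-STEP TOWER, BY VALUE, IN HSTB's BINDERS** (`hm`, `hmm`, `hnM`, `hnMμ` of
`…HardStepTowerBox.closing_conditions`): with `m := (L² − 1)⁻¹`, `m₂′ := t²·m₂∕d_T²` as above and `μ := √N_max` bounding
`‖M₂‖ = nM`, `0 < m`, `m ≤ m₂′`, and `0 ≤ nM ≤ μ` whenever `nM² ≤ N_max` (§3). [folklore] -/
theorem model_letters_by_value {L : ℝ} (hL : 1 < L) (d : ℕ) {nM Nmax : ℝ} (hnM : 0 ≤ nM) (hμ : nM ^ 2 ≤ Nmax) :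
    0 < (L ^ 2 - 1)⁻¹ ∧
      (L ^ 2 - 1)⁻¹ ≤ L ^ 2 / L ^ d * (L ^ 2 * (L ^ 2 - 1))⁻¹ / (L ^ d)⁻¹ ∧
      0 ≤ nM ∧ nM ≤ Real.sqrt Nmax := by
  refine ⟨inv_pos.mpr (by nlinarith), (closing_by_value hL d).symm.le, hnM, ?_⟩
  exact Real.le_sqrt_of_sq_le hμ

/-! ## §5. Toy -/

/-- Toy for §4: `L = 2`, `d = 4`: `t² = 1∕4`, `m₂ = 1∕12`, `d_T² = 1∕16`, and `t²m₂∕d_T² = 1∕3 = m`. -/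
example : (2 : ℝ) ^ 2 / 2 ^ 4 * (2 ^ 2 * (2 ^ 2 - 1))⁻¹ / (2 ^ 4)⁻¹ = (2 ^ 2 - 1)⁻¹ :=
  closing_by_value (by norm_num) 4

end Summit.QuantumFields.BalabanUV.T4Continuum.NE7b.TwoScalePoincareBlocking
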